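import Mathlib
import HarnessLib

/-!
# `DigitPolyUniformity` (stmt-QuantumAdvantage-1392), line `Sketch` — stub `stub_lift_oddDefect`
# (Stub E2: the `×p`-defect of the lift `f` of the chirp `φ`, `p` odd)

Crux `Summit.QuantumAdvantage.QuantumAdvantage.Theses.MobiusLadder.DigitPolyUniformity` (route
`MobiusLadder`); line `Sketch`, cycle 6 (chirps). With `K = V + k`, the lift `f` satisfies
`f(2^v r') = (−1)^v φ(r')` for every odd `r'` and `v < V`, where `φ` has period `2^k` (`k ≥ 1`),
and `p` is odd. For `r = 2^v r'` (`r'` odd, `v < V`) we have `p r = 2^v (p r')` with `p r'` odd,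
so `f(pr) = f(r)` forces `φ(p r') = φ(r')`, i.e. `u := r' mod 2^k` lies in
`Bad := {u < 2^k odd : φ(pu) = φ(u)}`; and `r = 2^v (u + 2^k q)` with `q < 2^{V−v}`. Every other
`r < 2^K` in the defect set is a multiple of `2^V` (there are `2^k` of them). Hence
`#{r < 2^K : f(pr) = f(r)} ≤ 2^k + #Bad · Σ_{v<V} 2^{V−v} ≤ 2^{V+1} · #Bad + 2^k`.

The hypothesis `1 ≤ k` is necessary: for `k = 0`, `V = 1`, `φ = f = 0`, `p = 1` the defect set
is all of `range 2` (card `2`) while the right-hand side is `1`.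
-/

noncomputable section

namespace Summit.QuantumAdvantage.DigitPolyUniformity.SketchLAR.Chirp

open Finset

/-- The geometric sum `Σ_{v<V} 2^{V−v} + 2 = 2^{V+1}`. [folklore] -/
theorem sum_two_pow_sub_add_two (V : ℕ) : ∑ v ∈ range V, 2 ^ (V - v) + 2 = 2 ^ (V + 1) := by
  induction V with
  | zero => simp
  | succ n ih =>
    rw [Finset.sum_range_succ, show n + 1 - n = 1 from by omega, pow_one]
    have h : ∑ v ∈ range n, (2 : ℕ) ^ (n + 1 - v) = 2 * ∑ v ∈ range n, 2 ^ (n - v) := by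
      rw [Finset.mul_sum]
      refine Finset.sum_congr rfl fun v hv => ?_
      rw [Finset.mem_range] at hv
      rw [show n + 1 - v = (n - v) + 1 from by omega, pow_succ]
      ring
    rw [h, pow_succ]
    omega

/-- Odd multipliers preserve the dyadic valuation: for `r'` odd, `v < V` and `p` odd,
`f(p · 2^v r') = f(2^v r')` forces `φ(p u) = φ(u)` for `u = r' mod 2^k` (`φ` of period `2^k`).
[folklore] -/
theorem phi_mul_eq_of_lift_eq (k V : ℕ) (φ : ℕ → ℝ) (hφper : ∀ u, φ (u % 2 ^ k) = φ u)
    (f : ℕ → ℝ) (hfv : ∀ v r', v < V → Odd r' → f (2 ^ v * r') = (-1) ^ v * φ r')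
    (p : ℕ) (hp : Odd p) (v r' : ℕ) (hv : v < V) (hr' : Odd r')
    (hf : f (p * (2 ^ v * r')) = f (2 ^ v * r')) :
    φ (p * (r' % 2 ^ k)) = φ (r' % 2 ^ k) := by
  rw [mul_left_comm, hfv v (p * r') hv (hp.mul hr'), hfv v r' hv hr'] at hf
  have hφ : φ (p * r') = φ r' := mul_left_cancel₀ (pow_ne_zero v (by norm_num)) hf
  rw [hφper, ← hφ, ← hφper (p * r'), ← hφper (p * (r' % 2 ^ k)), Nat.mul_mod_mod]

/-- **Stub E2, counting form in `ℕ`.** For odd `p` and `k ≥ 1`: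
`#{r < 2^{V+k} : f(pr) = f(r)} ≤ 2^{V+1} · #{u < 2^k odd : φ(pu) = φ(u)} + 2^k`. [folklore] -/
theorem card_lift_oddDefect_nat (k V : ℕ) (hk : 1 ≤ k) (φ : ℕ → ℝ)
    (hφper : ∀ u, φ (u % 2 ^ k) = φ u)
    (f : ℕ → ℝ) (hfv : ∀ v r', v < V → Odd r' → f (2 ^ v * r') = (-1) ^ v * φ r')
    (p : ℕ) (hp : Odd p) :
    ((range (2 ^ (V + k))).filter (fun r => f (p * r) = f r)).card ≤
      2 ^ (V + 1) * ((range (2 ^ k)).filter (fun u => Odd u ∧ φ (p * u) = φ u)).card + 2 ^ k := by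
  set Bad := (range (2 ^ k)).filter (fun u => Odd u ∧ φ (p * u) = φ u) with hBad
  -- the multiples of `2^V` below `2^{V+k}`
  set A₀ : Finset ℕ := (range (2 ^ k)).image (fun q => 2 ^ V * q) with hA₀
  -- the pieces `2^v (u + 2^k q)`, `u ∈ Bad`, `q < 2^{V-v}`
  set S : ℕ → Finset ℕ := fun v =>
    (Bad ×ˢ range (2 ^ (V - v))).image (fun uq => 2 ^ v * (uq.1 + 2 ^ k * uq.2)) with hS
  have hcover :
      (range (2 ^ (V + k))).filter (fun r => f (p * r) = f r) ⊆ A₀ ∪ (range V).biUnion S := by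
    intro r hr
    rw [mem_filter, mem_range] at hr
    obtain ⟨hrK, hrf⟩ := hr
    rw [mem_union]
    by_cases hdiv : 2 ^ V ∣ r
    · left
      obtain ⟨q, rfl⟩ := hdiv
      rw [hA₀, mem_image]
      refine ⟨q, mem_range.mpr ?_, rfl⟩
      rw [pow_add] at hrK
      exact lt_of_mul_lt_mul_left hrK (Nat.zero_le _)
    · right
      have hr0 : r ≠ 0 := by
        rintro rfl
        exact hdiv (dvd_zero _)
      obtain ⟨v, r', hr', rfl⟩ := Nat.exists_eq_two_pow_mul_odd hr0
      have hvV : v < V := by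
        by_contra h
        exact hdiv (dvd_mul_of_dvd_left (pow_dvd_pow 2 (not_lt.mp h)) _)
      rw [mem_biUnion]
      refine ⟨v, mem_range.mpr hvV, ?_⟩
      rw [hS, mem_image]
      refine ⟨(r' % 2 ^ k, r' / 2 ^ k), ?_, ?_⟩
      · rw [mem_product, hBad, mem_filter, mem_range, mem_range]
        refine ⟨⟨Nat.mod_lt _ (by positivity), ?_, ?_⟩, ?_⟩
        · -- `r' mod 2^k` is odd since `2 ∣ 2^k`
          rw [Nat.odd_iff, Nat.mod_mod_of_dvd _ (dvd_pow_self 2 (by omega))]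
          exact Nat.odd_iff.mp hr'
        · exact phi_mul_eq_of_lift_eq k V φ hφper f hfv p hp v r' hvV hr' hrf
        · -- `r' / 2^k < 2^{V-v}` from `2^v r' < 2^{V+k} = 2^v (2^{V-v} 2^k)`
          have hpow : 2 ^ (V + k) = 2 ^ v * (2 ^ (V - v) * 2 ^ k) := by
            rw [← pow_add, ← pow_add]
            congr 1
            omega
          rw [hpow] at hrK
          rw [Nat.div_lt_iff_lt_mul (by positivity)]
          exact lt_of_mul_lt_mul_left hrK (Nat.zero_le _)
      · simp only
        rw [Nat.mod_add_div]
  have hcardA₀ : A₀.card ≤ 2 ^ k := card_image_le.trans (card_range _).le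
  have hcardS : ∀ v ∈ range V, (S v).card ≤ Bad.card * 2 ^ (V - v) := fun v _ =>
    card_image_le.trans (by rw [card_product, card_range])
  have hgeom : ∑ v ∈ range V, 2 ^ (V - v) ≤ 2 ^ (V + 1) := by
    have := sum_two_pow_sub_add_two V
    omega
  calc ((range (2 ^ (V + k))).filter (fun r => f (p * r) = f r)).card
      ≤ (A₀ ∪ (range V).biUnion S).card := card_le_card hcover
    _ ≤ A₀.card + ((range V).biUnion S).card := card_union_le _ _
    _ ≤ 2 ^ k + ∑ v ∈ range V, (S v).card := add_le_add hcardA₀ card_biUnion_le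
    _ ≤ 2 ^ k + ∑ v ∈ range V, Bad.card * 2 ^ (V - v) := by
        gcongr with v hv
        exact hcardS v hv
    _ = 2 ^ k + Bad.card * ∑ v ∈ range V, 2 ^ (V - v) := by rw [mul_sum]
    _ ≤ 2 ^ k + Bad.card * 2 ^ (V + 1) := by gcongr
    _ = 2 ^ (V + 1) * Bad.card + 2 ^ k := by ring

/-- **Stub E2 (×p-defect of the lift, `p` odd).** For odd `p` and `k ≥ 1`,
`f(p · 2^v r') = (−1)^v φ(p r')`, so `f(pr) = f(r)` with `2^V ∤ r` forces `φ(pu) = φ(u)` for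
`u = r' mod 2^k`; counting `r = 2^v(u + 2^k q)` over `v < V`, `q < 2^{V−v}` and adding the `2^k`
multiples of `2^V`: `#{r < 2^{V+k} : f(pr) = f(r)} ≤ 2^{V+1}·#{u < 2^k odd : φ(pu) = φ(u)} + 2^k`.
(The hypothesis `1 ≤ k` is necessary: `k = 0`, `V = 1`, `φ = f = 0`, `p = 1` gives `2 ≤ 1`.)
[folklore] -/
theorem stub_lift_oddDefect (k V : ℕ) (hk : 1 ≤ k) (φ : ℕ → ℝ) (hφper : ∀ u, φ (u % 2 ^ k) = φ u)
    (f : ℕ → ℝ) (hfv : ∀ v r', v < V → Odd r' → f (2 ^ v * r') = (-1) ^ v * φ r')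
    (p : ℕ) (hp : Odd p) :
    ((((range (2 ^ (V + k))).filter (fun r => f (p * r) = f r)).card : ℕ) : ℝ) ≤
      2 ^ (V + 1) * (((range (2 ^ k)).filter (fun u => Odd u ∧ φ (p * u) = φ u)).card : ℝ) + 2 ^ k := by
  exact_mod_cast card_lift_oddDefect_nat k V hk φ hφper f hfv p hp

end Summit.QuantumAdvantage.DigitPolyUniformity.SketchLAR.Chirp

end
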